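import Mathlib
import Literature.Computability.MetaComplexity.ZeroErrorMCSPLightConeLowerBound
import Literature.Computability.MetaComplexity.ChenJinWilliams2020.ExplicitObstructions
import Literature.Computability.MetaComplexity.OliveiraSanthanam2018.MCSPZeroErrorFormulaMagnification
import HarnessLib

/-!
# `MCSP[s]` is not zero-error solvable on average by small juntas — in particular by De Morgan
# formulas with few leaves (census rows R33 and R55-formula, KNOWN column)

Topic `Computability/MetaComplexity`; the junta form of `ZeroErrorMCSPLightConeLowerBound.lean`.
That file proves: a zero-error pair (value `v`, flag `d`; Oliveira–Santhanam FOCS 2018 p. 5 /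
Chen–Jin–Williams 2019 §1.1.2; tree notion `OliveiraSanthanam2018.ZESolvableFracAt q 𝒞 L n`, any
confidence `1 - 1/q`, `q ≥ 2`) of `B₂`-CIRCUITS with `t` gates cannot solve `MCSP[s]` at length `2^m`
once `(t+1)(m+1) ≤ s(m) + 1` and the circuit count at threshold `s(m)` is below `2^{2^m - 2t - 2}`.
The only property of a `t`-gate `B₂`-circuit used there is that its output is a JUNTA on its light
cone (`≤ t + 1` variables). This file states the argument for an arbitrary class of `K`-juntas
(`not_ZESolvableFracAt_MCSPSize_of_junta`) and instantiates it for FORMULAS, whose light cone has at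
most `leafSize` variables in ANY basis (`ChenJinWilliams2020.card_lightCone_le_leafSize`): De Morgan
formulas with `ℓ` leaves (`ChenJinWilliams2020.deMorganFormulaFns`, size = leaves, the convention of
both rows below) are `ℓ`-juntas (`ChenJinWilliams2020.deMorganFormulaFns_junta`).

Two magnification rows of the census have zero-error FORMULA hypotheses far below input length
`N = 2^m`, both recorded **T-ONLY** (no lower bound in the zero-error model is stated in the sources;
the K cell of R33 in print is Hirahara–Santhanam's WORST-CASE formula bound, a model mismatch):

* census row **R33** (`MagnificationGapCensus.gap_R33`, part `MagnificationGapCensus/ZeroErrorFormulas`;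
  Oliveira–Santhanam FOCS 2018 Thm. 5 p. 5, fact `OliveiraSanthanam2018.thm5`): `MCSP[2^{√m}]`
  (`OliveiraSanthanam2018.twoPowSqrt`) at length `N = 2^m` is not zero-error solvable with confidence
  `1/2` by De Morgan formulas with `o(N)` leaves — NEEDED for EVERY `t = o(N)`, failure infinitely often
  (`¬ OliveiraSanthanam2018.MCSPZESolvableSublinearFormula`);
* census row **R55-formula** (`MagnificationGapCensus.gap_R55_formula`; Chen–Jin–Williams 2019 Thm. 1.10,
  first bullet, `𝒞 = Formula`, fact `ChenJinWilliams2019.thm110_MCSP_formula`): for some `s(m) ≥ m`,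
  `MCSP[s]` at length `2^m` is not zero-error solvable (`q = N`) by De Morgan formulas with `s(m)ᵏ + k`
  leaves, for every `k` (`¬ ChenJinWilliams2019.MCSPZESolvableFormula s`).

## What is proved here (all kernel-checked, no named facts used)

* `ChenJinWilliams2019.not_ZESolvableFracAt_MCSPSize_of_junta` (**single length**): if every member
  of `𝒞 (2^m)` is a `K`-junta, `m ≥ 1`, `s(m) ≥ 1`, `K(m+1) ≤ s(m) + 1` and the count of `m`-variable
  functions of `B₂`-complexity `≤ s(m)` is below `2^{2^m - 2K}`, then `MCSP[s]` at length `2^m` is not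
  zero-error solvable (any `q ≥ 2`) by a pair from `𝒞`. Proof as in the light-cone file with the
  junta sets in place of the light cones: a defined input `x₀`; `z := x₀` on the flag's junta set `S_d`,
  `0` elsewhere, is defined and tabulates the indicator of `≤ K` points, of complexity
  `≤ K(m+1) - 1 ≤ s(m)` (`Complexity.circuitSizeOver_memFinset_le`), hence accepted; the cylinder over
  `S_v ∪ S_d` through `z` (`≥ 2^{2^m - 2K}` points) lies inside `MCSP[s]` — too many functions of
  complexity `≤ s(m)`.
* `ChenJinWilliams2020.circuitFns_junta`, `deMorganFormulaFns_junta`, `b2FormulaFns_junta`,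
  `ChenJinWilliams2019.b2CircuitFns_junta`: the junta property of the device classes.
* `ChenJinWilliams2019.eventually_circuitCount_lt_two_pow_sub`: the counting numerics in the regime
  `s(m) ≤ ⌈2^{βm}⌉` eventually (`β < 1`): eventually, for every `K ≤ s(m)`, the count at threshold
  `s(m)` is below `2^{2^m - 2K}`.
* `ChenJinWilliams2019.eventually_not_ZESolvableFracAt_MCSPSize_formula` (**the KNOWN cells**): for
  `q ≥ 2` and `s` with `1 ≤ s(m) ≤ ⌈2^{βm}⌉` eventually (`β < 1`), for all large `m`, `MCSP[s]` at length
  `2^m` is not zero-error solvable with confidence `1 - 1/q` by pairs of De Morgan formulas with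
  `s(m)/(m+1)` leaves each; `…_of_sizeRegime` / `eventually_not_ZESolvableAt_MCSPSize_formula` are the
  row-R55-formula forms (`ChenJinWilliams2019.SizeRegime s`; NEEDED `s(m)ᵏ + k` leaves for every `k`),
  and `OliveiraSanthanam2018.eventually_not_ZESolvableFracAt_MCSP_twoPowSqrt_formula` /
  `…_formula_log` the row-R33 forms: `MCSP[2^{√m}]` is not zero-error solvable with confidence `1/2`
  by De Morgan formulas with `t₀(N) = ⌊2^{√m}⌋/(m+1)` leaves (`m = log N`), at ALL large `N = 2^m`,
  where `t₀ = o(N)` (`OliveiraSanthanam2018.isLittleO_leafBudget_twoPowSqrt`; indeed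
  `t₀(N) = N^{1/√(log N)}/(log N + 1) = N^{o(1)}`) — ONE sublinear leaf budget at which the NEEDED
  statement ("every `o(N)` budget fails infinitely often") is verified, the gap being `N^{o(1)}`
  versus `o(N)` leaves.

Presearch for the KNOWN column (2026-08-19, both corpora): corpus fts+vec "zero-error average-case
formula lower bound MCSP" → Oliveira–Santhanam 2018 pp. 2, 5 (hypothesis; contrast only with the
worst-case bound of Hirahara–Santhanam CCC 2017), Hirahara–Santhanam 2017 (worst case); galaxy pdf
"zero-error average-case|errorless heuristic|zero-error heuristics" → no formula lower bound for
`MCSP` in the zero-error model. The bound here is elementary and is not claimed to be in print.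
-/

open Finset Filter Topology

/-! ### Junta classes -/

namespace Literature.Computability.MetaComplexity.ChenJinWilliams2020

open Literature.Computability.Complexity Literature.Computability.Complexity.Circuit

/-- Members of a constrained circuit class whose light cones have at most `K` variables are
`K`-juntas. [folklore] -/
theorem circuitFns_junta {P : ∀ n : ℕ, Circuit (Fin n) → Prop} {n K : ℕ}
    (hP : ∀ C : Circuit (Fin n), P n C → C.lightCone.card ≤ K) :
    ∀ f ∈ circuitFns P n, ∃ S : Finset (Fin n), S.card ≤ K ∧
      ∀ x x' : Fin n → Bool, (∀ i ∈ S, x i = x' i) → f x = f x' := by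
  rintro f ⟨C, hPC, hCf⟩
  exact ⟨C.lightCone, hP C hPC, fun x x' h => by rw [← hCf x, ← hCf x', C.eval_congr_lightCone h]⟩

/-- **De Morgan formulas with `ℓ` leaves are `ℓ`-juntas.** [folklore] -/
theorem deMorganFormulaFns_junta (t : ℕ → ℕ) (n : ℕ) :
    ∀ f ∈ deMorganFormulaFns t n, ∃ S : Finset (Fin n), S.card ≤ t n ∧
      ∀ x x' : Fin n → Bool, (∀ i ∈ S, x i = x' i) → f x = f x' :=
  circuitFns_junta fun C hC => (card_lightCone_le_leafSize C).trans hC.2.2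

/-- `B₂`-formulas with `ℓ` leaves are `ℓ`-juntas. [folklore] -/
theorem b2FormulaFns_junta (t : ℕ → ℕ) (n : ℕ) :
    ∀ f ∈ b2FormulaFns t n, ∃ S : Finset (Fin n), S.card ≤ t n ∧
      ∀ x x' : Fin n → Bool, (∀ i ∈ S, x i = x' i) → f x = f x' :=
  circuitFns_junta fun C hC => (card_lightCone_le_leafSize C).trans hC.2.2

end Literature.Computability.MetaComplexity.ChenJinWilliams2020

namespace Literature.Computability.MetaComplexity.ChenJinWilliams2019

open Literature.Computability.Complexity Literature.Computability.Complexity.Circuit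
open Literature.Computability.Complexity.CircuitCount
open Literature.Computability.MetaComplexity Literature.Computability.MetaComplexity.ChenJinWilliams2020

/-- `B₂`-circuits with `t` gates are `(t+1)`-juntas. [folklore] -/
theorem b2CircuitFns_junta (t : ℕ → ℕ) (n : ℕ) :
    ∀ f ∈ b2CircuitFns t n, ∃ S : Finset (Fin n), S.card ≤ t n + 1 ∧
      ∀ x x' : Fin n → Bool, (∀ i ∈ S, x i = x' i) → f x = f x' :=
  ChenJinWilliams2020.circuitFns_junta fun C hC =>
    (C.card_lightCone_le_size_succ hC.1).trans (by simpa using hC.2)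

/-! ### The junta lower bound at one length -/

/-- **Zero-error `MCSP[s]` (any confidence `1 - 1/q`, `q ≥ 2`) is not solved by pairs of
`K`-juntas** whenever `m ≥ 1`, `s(m) ≥ 1`, `K(m+1) ≤ s(m) + 1` (every pattern on `K` positions of a
truth table extends to a YES instance) and the circuit count at threshold `s(m)` is below
`2^{2^m - 2K}` (the joint fibre of the pair). See the module docstring. [folklore] -/
theorem not_ZESolvableFracAt_MCSPSize_of_junta {q : ℕ} (hq : 2 ≤ q) {s : ℕ → ℕ} {K m : ℕ}
    (hm : 1 ≤ m) {𝒞 : ∀ n : ℕ, Set ((Fin n → Bool) → Bool)}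
    (h𝒞 : ∀ f ∈ 𝒞 (2 ^ m), ∃ S : Finset (Fin (2 ^ m)), S.card ≤ K ∧
      ∀ x x' : Fin (2 ^ m) → Bool, (∀ i ∈ S, x i = x' i) → f x = f x')
    (hs1 : 1 ≤ s m) (hK : K * (m + 1) ≤ s m + 1)
    (hcount : (s m + 1) * (16 * (m + s m + 1) ^ 2) ^ s m * (m + s m + 1) <
      2 ^ (2 ^ m - 2 * K)) :
    ¬ OliveiraSanthanam2018.ZESolvableFracAt q 𝒞 (MCSPSize s) (2 ^ m) := by
  -- `m = k + 1`
  obtain ⟨k, rfl⟩ : ∃ k, m = k + 1 := ⟨m - 1, by omega⟩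
  rintro ⟨v, hv, d, hd, hze⟩
  obtain ⟨Sv, hSv, hvS⟩ := h𝒞 v hv
  obtain ⟨Sd, hSd, hdS⟩ := h𝒞 d hd
  -- the function tabulated by an input of length `2^m`
  let e := boolFunEquivFin (k + 1)
  let tbl : (Fin (2 ^ (k + 1)) → Bool) → ((Fin (k + 1) → Bool) → Bool) := fun x w => x (e w)
  have htbl_inj : Function.Injective tbl := by
    intro x x' h
    funext i
    have := congrFun h (e.symm i)
    simpa [tbl, e] using this
  have htbl_tt : ∀ x, truthTable (tbl x) = List.ofFn x := by
    intro x
    simp [truthTable, tbl, e]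
  have hslice : ∀ x : Fin (2 ^ (k + 1)) → Bool,
      sliceFn (MCSPSize s) (2 ^ (k + 1)) x = true ↔ circuitSizeOver B2 (tbl x) ≤ s (k + 1) := by
    intro x
    rw [← truthTable_mem_MCSPSize_iff, htbl_tt]
    exact (Set.mem_iff_boolIndicator _ _).symm
  -- a defined input `x₀`
  obtain ⟨x₀, hx₀⟩ := hze.exists_defined hq
  -- the YES instance `z`: `x₀` on the junta set of `d`, `0` elsewhere
  let z : Fin (2 ^ (k + 1)) → Bool := fun i => decide (i ∈ Sd) && x₀ i
  have hz_agree : ∀ i ∈ Sd, z i = x₀ i := by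
    intro i hi
    simp [z, hi]
  have hdz : d z = true := by rw [hdS z x₀ hz_agree, hx₀]
  -- `z` tabulates the indicator of `T`, at most `|S_d| ≤ K` points
  let T : Finset (Fin (k + 1) → Bool) := univ.filter fun w => e w ∈ Sd ∧ x₀ (e w) = true
  have htblz : tbl z = fun w => decide (w ∈ T) := by
    funext w
    simp [tbl, z, T]
  have hTcard : T.card ≤ K := by
    have h1 : T.card ≤ Sd.card :=
      card_le_card_of_injOn e (fun w hw => by
        simp only [T, coe_filter, Set.mem_setOf_eq, mem_univ, true_and] at hw
        exact hw.1) e.injective.injOn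
    omega
  have hzsmall : circuitSizeOver B2 (tbl z) ≤ s (k + 1) := by
    rw [htblz]
    rcases T.eq_empty_or_nonempty with hT | hT
    · have hconst : (fun w : Fin (k + 1) → Bool => decide (w ∈ T)) = fun _ => false := by
        funext w
        simp [hT]
      rw [hconst]
      have h0 := circuitSizeOver_const_false_le (Fin (k + 1))
      omega
    · have h1 := circuitSizeOver_memFinset_le T hT
      have h3 : T.card * (k + 2) ≤ K * (k + 1 + 1) := Nat.mul_le_mul hTcard le_rfl
      omega
  have hvz : v z = true := by
    rw [hze.correct hdz]
    exact (hslice z).2 hzsmall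
  -- the joint fibre over `J = S_v ∪ S_d`
  let J : Finset (Fin (2 ^ (k + 1))) := Sv ∪ Sd
  have hJ : J.card ≤ 2 * K := by
    calc J.card ≤ Sv.card + Sd.card := card_union_le _ _
      _ ≤ 2 * K := by omega
  have hfib : ∀ x : Fin (2 ^ (k + 1)) → Bool, (∀ i ∈ J, x i = z i) →
      circuitSizeOver B2 (tbl x) ≤ s (k + 1) := by
    intro x hx
    have hdx : d x = true := by
      rw [hdS x z (fun i hi => hx i (mem_union_right _ hi)), hdz]
    have hvx : v x = v z := hvS x z fun i hi => hx i (mem_union_left _ hi)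
    have hx1 : sliceFn (MCSPSize s) (2 ^ (k + 1)) x = true := by
      rw [← hze.correct hdx, hvx, hvz]
    exact (hslice x).1 hx1
  have key : 2 ^ (2 ^ (k + 1) - 2 * K) ≤
      (s (k + 1) + 1) * (16 * ((k + 1) + s (k + 1) + 1) ^ 2) ^ s (k + 1) *
        ((k + 1) + s (k + 1) + 1) :=
    calc 2 ^ (2 ^ (k + 1) - 2 * K)
        ≤ 2 ^ (Fintype.card (Fin (2 ^ (k + 1))) - J.card) :=
          Nat.pow_le_pow_right (by norm_num) (by simp only [Fintype.card_fin]; omega)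
      _ ≤ #{x : Fin (2 ^ (k + 1)) → Bool | ∀ i ∈ J, x i = z i} := by
          convert two_pow_le_card_filter_agree J z
      _ ≤ #{f : (Fin (k + 1) → Bool) → Bool | circuitSizeOver B2 f ≤ s (k + 1)} := by
          refine card_le_card_of_injOn tbl (fun x hx => ?_) htbl_inj.injOn
          simp only [coe_filter, Set.mem_setOf_eq, mem_univ, true_and] at hx ⊢
          exact hfib x hx
      _ ≤ _ := card_filter_circuitSizeOver_le (k + 1) (s (k + 1))
  exact absurd key (not_le.2 hcount)

/-! ### Numerics in the regime `s(m) ≤ ⌈2^{βm}⌉`, `β < 1` -/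

/-- Eventually, for every `K ≤ s(m)`, the circuit count at threshold `s(m)` is below `2^{2^m - 2K}`
(`s(m) ≤ ⌈2^{βm}⌉` eventually, `β < 1`). [folklore] -/
theorem eventually_circuitCount_lt_two_pow_sub {s : ℕ → ℕ} {β : ℝ} (hβ0 : 0 ≤ β) (hβ1 : β < 1)
    (hsβ : ∀ᶠ m : ℕ in atTop, s m ≤ OliveiraPichSanthanam2019.noBound β m) :
    ∀ᶠ m : ℕ in atTop, ∀ K : ℕ, K ≤ s m →
      (s m + 1) * (16 * (m + s m + 1) ^ 2) ^ s m * (m + s m + 1) < 2 ^ (2 ^ m - 2 * K) := by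
  obtain ⟨β', hββ', hβ'1⟩ : ∃ β' : ℝ, β < β' ∧ β' < 1 := ⟨(β + 1) / 2, by linarith, by linarith⟩
  have hβ'0 : 0 < β' := by linarith
  have hA := eventually_circuitCount_noBound_lt hβ0 hββ' hβ'1
  have hB : ∀ᶠ m : ℕ in atTop, 3 * ⌈((2 ^ m : ℕ) : ℝ) ^ β'⌉₊ + 1 ≤ 2 ^ m :=
    (tendsto_pow_atTop_atTop_of_one_lt (one_lt_two : (1 : ℕ) < 2)).eventually
      (eventually_three_mul_ceil_rpow_succ_le hβ'0 hβ'1)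
  filter_upwards [hA, hB, hsβ] with m hAm hBm hsm K hK
  have hcast : (((2 ^ m : ℕ) : ℝ)) = (2 : ℝ) ^ (m : ℕ) := by push_cast; ring
  have hTpow : ((2 ^ m : ℕ) : ℝ) ^ β' = (2 : ℝ) ^ (β' * m) := by
    rw [hcast, ← Real.rpow_natCast (2 : ℝ) m, ← Real.rpow_mul (by norm_num)]
    congr 1; ring
  have hsT : s m ≤ ⌈((2 ^ m : ℕ) : ℝ) ^ β'⌉₊ := by
    refine hsm.trans ?_
    unfold OliveiraPichSanthanam2019.noBound
    rw [hTpow]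
    exact Nat.ceil_mono (Real.rpow_le_rpow_of_exponent_le (by norm_num)
      (mul_le_mul_of_nonneg_right hββ'.le (Nat.cast_nonneg m)))
  generalize hT : ⌈((2 ^ m : ℕ) : ℝ) ^ β'⌉₊ = T at hAm hBm hsT
  calc (s m + 1) * (16 * (m + s m + 1) ^ 2) ^ s m * (m + s m + 1)
      ≤ (OliveiraPichSanthanam2019.noBound β m + 1) *
            (16 * (m + OliveiraPichSanthanam2019.noBound β m + 1) ^ 2) ^
              OliveiraPichSanthanam2019.noBound β m *
          (m + OliveiraPichSanthanam2019.noBound β m + 1) := circuitCount_mono m hsm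
    _ < 2 ^ (2 ^ m - (2 ^ m - T) - 1) := hAm
    _ ≤ 2 ^ (2 ^ m - 2 * K) := Nat.pow_le_pow_right (by norm_num) (by omega)

/-! ### The KNOWN cells: De Morgan formulas with `s(m)/(m+1)` leaves -/

/-- **`MCSP[s]` is not zero-error solvable (confidence `1 - 1/q`, any `q ≥ 2`) by pairs of De Morgan
formulas with `s(m)/(m+1)` leaves**, for all large `m`, whenever `1 ≤ s(m) ≤ ⌈2^{βm}⌉` eventually
(`β < 1`). [folklore] -/
theorem eventually_not_ZESolvableFracAt_MCSPSize_formula {q : ℕ} (hq : 2 ≤ q) {s : ℕ → ℕ} {β : ℝ}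
    (hβ0 : 0 ≤ β) (hβ1 : β < 1) (hsβ : ∀ᶠ m : ℕ in atTop, s m ≤ OliveiraPichSanthanam2019.noBound β m)
    (hs1 : ∀ᶠ m : ℕ in atTop, 1 ≤ s m) :
    ∀ᶠ m : ℕ in atTop, ¬ OliveiraSanthanam2018.ZESolvableFracAt q
      (ChenJinWilliams2020.deMorganFormulaFns fun _ => s m / (m + 1)) (MCSPSize s) (2 ^ m) := by
  filter_upwards [eventually_circuitCount_lt_two_pow_sub hβ0 hβ1 hsβ, hs1, eventually_ge_atTop 1]
    with m hcnt hs1m hm1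
  exact not_ZESolvableFracAt_MCSPSize_of_junta hq hm1
    (ChenJinWilliams2020.deMorganFormulaFns_junta _ _) hs1m
    ((Nat.div_mul_le_self (s m) (m + 1)).trans (Nat.le_succ _))
    (hcnt _ (Nat.div_le_self _ _))

/-- The same in the size regime `m ≤ s(m) ≤ 2^{cm}` (`c < 1`) of the census rows
(`SizeRegime`). [folklore] -/
theorem eventually_not_ZESolvableFracAt_MCSPSize_formula_of_sizeRegime {q : ℕ} (hq : 2 ≤ q)
    {s : ℕ → ℕ} (hs : SizeRegime s) :
    ∀ᶠ m : ℕ in atTop, ¬ OliveiraSanthanam2018.ZESolvableFracAt q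
      (ChenJinWilliams2020.deMorganFormulaFns fun _ => s m / (m + 1)) (MCSPSize s) (2 ^ m) := by
  obtain ⟨β, hβ0, hβ1, hsβ⟩ := hs.exists_eventually_le_noBound
  exact eventually_not_ZESolvableFracAt_MCSPSize_formula hq hβ0 hβ1 hsβ
    ((eventually_ge_atTop 1).mono fun m hm => hm.trans (hs.1 m))

/-- **Row R55-formula, KNOWN column** in Chen–Jin–Williams' notion (`Pr[?] ≤ 1/N`,
`ChenJinWilliams2019.ZESolvableAt`): for every `s` in the size regime and all large `m`, `MCSP[s]` at
length `2^m` is not zero-error solvable by pairs of De Morgan formulas with `s(m)/(m+1)` leaves.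
NEEDED by Thm. 1.10 (first bullet, `𝒞 = Formula`): the same with `s(m)ᵏ + k` leaves for every `k`
(`¬ MCSPZESolvableFormula s`). [folklore] -/
theorem eventually_not_ZESolvableAt_MCSPSize_formula {s : ℕ → ℕ} (hs : SizeRegime s) :
    ∀ᶠ m : ℕ in atTop, ¬ ZESolvableAt
      (ChenJinWilliams2020.deMorganFormulaFns fun _ => s m / (m + 1)) (MCSPSize s) (2 ^ m) := by
  filter_upwards [eventually_not_ZESolvableFracAt_MCSPSize_formula_of_sizeRegime (le_refl 2) hs,
    eventually_ge_atTop 1] with m hm hm1 hze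
  refine hm (OliveiraSanthanam2018.ZESolvableFracAt.of_zeSolvableAt hze ?_)
  calc 2 = 2 ^ 1 := (pow_one 2).symm
    _ ≤ 2 ^ m := Nat.pow_le_pow_right (by norm_num) hm1

end Literature.Computability.MetaComplexity.ChenJinWilliams2019

/-! ### Row R33: `MCSP[2^{√m}]` versus De Morgan formulas, confidence `1/2` -/

namespace Literature.Computability.MetaComplexity.OliveiraSanthanam2018

open Asymptotics

/-- `1 ≤ ⌊2^{√m}⌋`. [folklore] -/
theorem one_le_twoPowSqrt (m : ℕ) : 1 ≤ twoPowSqrt m := by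
  unfold twoPowSqrt
  rw [Nat.one_le_floor_iff]
  exact_mod_cast Real.one_le_rpow (by norm_num : (1 : ℝ) ≤ 2) (Real.sqrt_nonneg _)

/-- `⌊2^{√m}⌋ ≤ ⌈2^{m/2}⌉` for `m ≥ 4` (so `twoPowSqrt` is in the counting regime with `β = 1/2`).
[folklore] -/
theorem twoPowSqrt_le_noBound_half {m : ℕ} (hm : 4 ≤ m) :
    twoPowSqrt m ≤ OliveiraPichSanthanam2019.noBound (1 / 2) m := by
  unfold twoPowSqrt OliveiraPichSanthanam2019.noBound
  have hm' : (4 : ℝ) ≤ m := by exact_mod_cast hm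
  have hsqrt : Real.sqrt m ≤ 1 / 2 * m := by
    have h0 : (0 : ℝ) ≤ 1 / 2 * m := by positivity
    calc Real.sqrt m ≤ Real.sqrt ((1 / 2 * m) ^ 2) := Real.sqrt_le_sqrt (by nlinarith)
      _ = 1 / 2 * m := Real.sqrt_sq h0
  have h : (2 : ℝ) ^ Real.sqrt m ≤ (2 : ℝ) ^ ((1 / 2 : ℝ) * m) :=
    Real.rpow_le_rpow_of_exponent_le (by norm_num) hsqrt
  exact (Nat.floor_le_floor h).trans (Nat.floor_le_ceil _)

/-- Eventually `⌊2^{√m}⌋ ≤ ⌈2^{m/2}⌉`. [folklore] -/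
theorem eventually_twoPowSqrt_le_noBound_half :
    ∀ᶠ m : ℕ in atTop, twoPowSqrt m ≤ OliveiraPichSanthanam2019.noBound (1 / 2) m :=
  (eventually_ge_atTop 4).mono fun _ hm => twoPowSqrt_le_noBound_half hm

/-- **Row R33, KNOWN column (proved)**: for all large `m`, `MCSP[2^{√m}]` at length `N = 2^m` is not
zero-error solvable with confidence `1/2` by pairs of De Morgan formulas with `⌊2^{√m}⌋/(m+1)` leaves
(`= N^{1/√(log N)}/(log N + 1) = N^{o(1)}`). NEEDED (Oliveira–Santhanam Thm. 5): for EVERY leaf budget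
`t = o(N)`, failure infinitely often. [folklore] -/
theorem eventually_not_ZESolvableFracAt_MCSP_twoPowSqrt_formula :
    ∀ᶠ m : ℕ in atTop, ¬ ZESolvableFracAt 2
      (ChenJinWilliams2020.deMorganFormulaFns fun _ => twoPowSqrt m / (m + 1)) (MCSPSize twoPowSqrt)
        (2 ^ m) :=
  ChenJinWilliams2019.eventually_not_ZESolvableFracAt_MCSPSize_formula (le_refl 2)
    (by norm_num : (0 : ℝ) ≤ 1 / 2) (by norm_num) eventually_twoPowSqrt_le_noBound_half
    (Eventually.of_forall one_le_twoPowSqrt)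

/-- **Row R33, KNOWN column, in the shape of the NEEDED statement**: with the leaf budget
`t₀(N) = ⌊2^{√(log N)}⌋/(log N + 1)` (a function of the input length, `log = Nat.log 2`), for all
large `n`, `MCSP[2^{√m}]` at length `2^n` is not zero-error solvable with confidence `1/2` by De Morgan
formulas with `t₀` leaves — so the NEEDED statement `∀ t = o(N), ∃ᶠ n, ¬ ZESolvableFracAt 2 …` holds
AT `t = t₀` (and `t₀ = o(N)`, `isLittleO_leafBudget_twoPowSqrt`). [folklore] -/
theorem eventually_not_ZESolvableFracAt_MCSP_twoPowSqrt_formula_log :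
    ∀ᶠ n : ℕ in atTop, ¬ ZESolvableFracAt 2
      (ChenJinWilliams2020.deMorganFormulaFns fun N => twoPowSqrt (Nat.log 2 N) / (Nat.log 2 N + 1))
        (MCSPSize twoPowSqrt) (2 ^ n) := by
  filter_upwards [ChenJinWilliams2019.eventually_circuitCount_lt_two_pow_sub
      (by norm_num : (0 : ℝ) ≤ 1 / 2) (by norm_num) eventually_twoPowSqrt_le_noBound_half,
    eventually_ge_atTop 1] with n hcnt hn1
  have hlog : Nat.log 2 (2 ^ n) = n := Nat.log_pow (by norm_num) n
  refine ChenJinWilliams2019.not_ZESolvableFracAt_MCSPSize_of_junta (le_refl 2) hn1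
    (ChenJinWilliams2020.deMorganFormulaFns_junta _ _) (one_le_twoPowSqrt n) ?_ ?_
  · rw [hlog]
    exact (Nat.div_mul_le_self _ _).trans (Nat.le_succ _)
  · rw [hlog]
    exact hcnt _ (Nat.div_le_self _ _)

/-- The leaf budget `t₀(N) = ⌊2^{√(log N)}⌋/(log N + 1)` is `o(N)`. [folklore] -/
theorem isLittleO_leafBudget_twoPowSqrt :
    (fun N : ℕ => ((twoPowSqrt (Nat.log 2 N) / (Nat.log 2 N + 1) : ℕ) : ℝ)) =o[atTop]
      (fun N : ℕ => (N : ℝ)) := by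
  refine (IsBigO.of_bound 1 (Eventually.of_forall fun N => ?_)).trans_isLittleO
    (isLittleO_twoPowSqrt_pow 1)
  rw [one_mul, Real.norm_natCast, Real.norm_natCast]
  exact_mod_cast (Nat.div_le_self _ _).trans (by rw [pow_one]; exact Nat.le_succ _)

end Literature.Computability.MetaComplexity.OliveiraSanthanam2018
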